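import Summits.QuantumFields.YangMills.Theorems.SlowBitWindowPersistenceChain
import Summits.QuantumFields.YangMills.Theorems.SwapTwistDeficitSmallBallFloors
import Summits.QuantumFields.YangMills.Theorems.SlowBitWindowJensenDoor
import Summits.QuantumFields.YangMills.Theorems.SwapTwistDeficitCauchySchwarzDoor
import HarnessLib

/-!
# DOOR: the Laplace-window twist deficit (`SwapTwistDeficit.TwistDeficitLaplaceWindow`, stmt-QuantumFields-23776) and the window slow bit
# (`SlowBitWindow.StepPersistence` on `L ≤ β^a`, stmt-QuantumFields-23271) follow from ONE thermal small-ball estimate for a single Polyakov pair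

LINE g11-A of seat ym-idea-4 split the crux `TwistDeficit` into the Laplace window W (`∃ a > 0`, L-UNIFORM exponent on `L₀ ≤ L ≤ β^a`) and a polynomial
tail; its planned mechanism for W is dimension-explicit Laplace asymptotics (`d³ ≪ β`).  This module proves a SOFTER sufficient condition.  Let
`p(U) = polDist U` be the Hilbert–Schmidt distance of the `x`-Polyakov holonomy through the origin to the centre, `S` the spatial axis swap, and

  (SB)(a, γ):  ∃ β₀ L₀, ∀ β ≥ β₀, ∀ L₀ ≤ L ≤ β^a:  `insTrace L β 𝟙{|p − p∘S| ≤ β^{−γ}} 0 ≤ (β^{−a}/8) · Z_phys(2L)`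

— in words: in the zero-flux thermal state of the `2L × L³` torus, the `x`- and `y`-holonomy distances-to-centre are `β^{−γ}`-close with probability at most
`β^{−a}/8`.  THEN (for `0 < a ≤ 1`, `γ < 1/2 − 3a`):

* ★ `stepPersistence_window_of_smallBall`: the sign witness `O = sign(p − p∘S)` has `β^{−1/L} Z_phys(2L) ≤ insTrace L β O 1` on the window (the conclusion of
  `StepPersistence` restricted to `L ≤ β^a`, `k = 1`) — NO smearing and NO multi-scale estimate: the displacement half is unconditional
  (`TT.insTrace_one_ge_of_persistence`: a link moving by `t`, `βt²/2 = (a + 2LN + 3) log β`, costs `β^{−a−3}·(β^{−N})^{2L} ≤ (β^{−a}/8)·Z/(e^{2β|E|})^{2L}`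
  against the explicit floor `Z ≥ (e^{2β|E|}β^{−N})^{2L}`, and the strip width `2Lt = O(L³√(log β/β))` is `≤ β^{−γ}` on the window);
* ★ `twistDeficitLaplaceWindow_of_smallBall`: W holds with this `a` and `k = 3` (Door 1 + the landed `JensenDoor` and `CauchySchwarzDoor`, pointwise in `(β,L)`).

So the Laplace window of BOTH trace-door lines reduces to an anti-concentration statement for ONE pair of Polyakov observables at a POLYNOMIAL scale
(`β^{−γ}` with room `γ < 1/2 − 3a`; probability `β^{−a}`), with no Gaussian precision on the bulk.  (SB) is NOT proved here and is not a published fact: it is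
the residual crux, to be filed by the planner.  HONEST FRAMING: a reduction between fixed-lattice statements; no summit / rung statement is proved; the YM mass
gap is NOT proved.  No `sorry`, no new axiom, no new definition.  References: [cite: tHooft1979Flux]; [cite: MadrasSokal1988, §2]; [cite: ReedSimonIV1978, Thm. XIII.1];
[cite: Luscher1983, §2]; [cite: SeilerLNP1982, §3].
-/

set_option autoImplicit false

noncomputable section

open MeasureTheory Filter Topology Real Function
open scoped Matrix ComplexConjugate BigOperators
open Literature.MathematicalPhysics.QuantumLattice
open Literature.MathematicalPhysics.QuantumFieldTheory hiding SU2
open Summit.QuantumFields.YangMills.Theorems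

namespace Summit.QuantumFields.YangMills.Theorems.SwapTwistDeficit

open Summit.QuantumFields.YangMills.Theorems.FemtoTransferGap
open Summit.QuantumFields.YangMills.Theorems.FemtoTransferGap.FlatSheet

/-! ## §5 The doors: window slow bit and Laplace-window twist deficit from ONE thermal small-ball estimate -/

set_option maxHeartbeats 800000 in
/-- ★ **DOOR 1 — the slow bit on the window `L ≤ β^a` from the thermal small-ball estimate.**  Let `0 < a ≤ 1` and `γ < 1/2 − 3a`.  SUPPOSE
(SB) there are `β₀, L₀` such that for all `β ≥ β₀` and `L₀ ≤ L ≤ β^a` the zero-flux thermal state of the `2L × L³` torus gives the strip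
`{|polDist − polDist∘S| ≤ β^{−γ}}` (the `x`- and `y`-Polyakov holonomies through the origin are `β^{−γ}`-close in distance-to-centre) weight at most
`β^{−a}/8`: `insTrace L β 𝟙_strip 0 ≤ (β^{−a}/8) · Z_phys(2L)`.  THEN the sign witness `O = sign(polDist − polDist∘S)` (physical, `|O| ≤ 1`, swap-odd)
has one-step autocorrelation `insTrace L β O 1 ≥ β^{−1/L} Z_phys(2L)` throughout the window — the conclusion of `SlowBitWindow.StepPersistence`
(stmt-QuantumFields-23271) restricted to `L ≤ β^a`, with `k = 1`.  Unconditional ingredients: the persistence bound along the chain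
(`TT.insTrace_one_ge_of_persistence`), the kernel's exponential suppression of a `t`-far link with `βt²/2 = (a + 2L·N + 3) log β`, the explicit floor
`Z_phys(2L) ≥ (e^{2β|E|} β^{−N})^{2L}` (`N = 8|P| + 97|E|`), and the width estimate `2Lt ≤ β^{−γ}` (`TT.stripWidth_le_rpow`).
[cite: MadrasSokal1988, §2] [cite: Luscher1983, §2] [cite: SeilerLNP1982, §3] -/
theorem stepPersistence_window_of_smallBall {a γ : ℝ} (ha : 0 < a) (ha1 : a ≤ 1) (hγ : γ < 1 / 2 - 3 * a)
    (hSB : ∃ β₀ : ℝ, ∃ L₀ : ℕ, ∀ β : ℝ, β₀ ≤ β → ∀ (L : ℕ) [NeZero L], L₀ ≤ L → (L : ℝ) ≤ β ^ a →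
      TT.insTrace L β (Set.indicator {U : GaugeConfig 3 L FemtoTransferGap.SU2 |
          |polDist U - polDist (configPerm (Equiv.swap (0 : Fin 3) 1) U)| ≤ β ^ (-γ)} fun _ => (1 : ℝ)) 0 ≤
        β ^ (-a) / 8 * TT.physTrace L β (2 * L)) :
    ∃ k β₀ : ℝ, ∃ L₀ : ℕ, ∀ β : ℝ, β₀ ≤ β → ∀ (L : ℕ) [NeZero L], L₀ ≤ L → (L : ℝ) ≤ β ^ a →
      ∃ O : GaugeConfig 3 L FemtoTransferGap.SU2 → ℝ, IsPhys O ∧ (∀ U, |O U| ≤ 1) ∧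
        (∀ U, O (configPerm (Equiv.swap (0 : Fin 3) 1) U) = -O U) ∧
        β ^ (-k / L) * TT.physTrace L β (2 * L) ≤ TT.insTrace L β O 1 := by
  obtain ⟨β₀, L₀, hSB⟩ := hSB
  obtain ⟨β₁, hβ₁9, hwidth⟩ := TT.stripWidth_le_rpow ha ha1 hγ
  set w₀ : ℝ := Real.exp (-(1 / 2 : ℝ)) * (8 / (3 * π ^ 3)) with hw₀
  refine ⟨1, max (max β₀ β₁) (4 / w₀), max L₀ 1, fun β hβ L _ hL hLβ => ?_⟩
  have hββ₀ : β₀ ≤ β := ((le_max_left _ _).trans (le_max_left _ _)).trans hβ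
  have hββ₁ : β₁ ≤ β := ((le_max_right _ _).trans (le_max_left _ _)).trans hβ
  have hβw : 4 / w₀ ≤ β := (le_max_right _ _).trans hβ
  have hβ9 : 9 ≤ β := hβ₁9.trans hββ₁
  have hβ1 : 1 ≤ β := by linarith
  have hβ0 : 0 < β := by linarith
  have hexp1 : Real.exp 1 ≤ β := by
    have h := Real.exp_one_lt_d9; norm_num at h; linarith
  have hL1 : 1 ≤ L := (le_max_right _ _).trans hL
  have hL₀ : L₀ ≤ L := (le_max_left _ _).trans hL
  have hLr : (1 : ℝ) ≤ L := by exact_mod_cast hL1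
  -- data
  set S := configPerm (G := FemtoTransferGap.SU2) (L := L) (Equiv.swap (0 : Fin 3) 1) with hS
  set E : ℕ := Fintype.card (Edge 3 L) with hE
  set P : ℕ := Fintype.card (Plaquette 3 L) with hP
  set N : ℕ := 8 * P + 97 * E with hN
  set M : ℝ := Real.exp (2 * β) ^ E with hM
  set Z : ℝ := TT.physTrace L β (2 * L) with hZ
  set c : ℝ := a + 2 * L * (8 * (P : ℝ) + 97 * (E : ℝ)) + 3 with hc
  set t : ℝ := Real.sqrt (2 * c * Real.log β / β) with ht
  have hM0 : 0 < M := by positivity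
  have hZpos : 0 < Z := TT.physTrace_two_mul_pos hL1 hβ1
  have hlog0 : 0 ≤ Real.log β := Real.log_nonneg hβ1
  have hc0 : 0 ≤ c := by rw [hc]; positivity
  have ht0 : 0 ≤ t := Real.sqrt_nonneg _
  -- the witness
  set O : GaugeConfig 3 L FemtoTransferGap.SU2 → ℝ := fun U => Real.sign (polDist U - polDist (S U)) with hO
  have hOP : IsPhys O := isPhys_signWitness
  have hOb : ∀ U, |O U| ≤ 1 := abs_signWitness_le_one
  have hodd : ∀ U, O (S U) = -O U := signWitness_swap
  refine ⟨O, hOP, hOb, hodd, ?_⟩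
  -- the persistence bound along the chain
  set A : Set (GaugeConfig 3 L FemtoTransferGap.SU2) := {U | |polDist U - polDist (S U)| ≤ 2 * L * t} with hA
  have hAm : MeasurableSet A := measurableSet_strip _
  have hpers := TT.insTrace_one_ge_of_persistence hL1 hβ0.le hOP.measurable hOb hAm ht0 (fun U V => one_sub_le_signWitness_mul U V t)
  -- (i) the strip term, by (SB) and monotonicity
  have hwid : 2 * (L : ℝ) * t ≤ β ^ (-γ) := by
    have h := hwidth β hββ₁ L hLβ
    simpa only [ht, hc] using h
  have hAB : A ⊆ {U | |polDist U - polDist (S U)| ≤ β ^ (-γ)} := fun U hU => le_trans hU hwid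
  have hstrip : TT.insTrace L β (A.indicator fun _ => (1 : ℝ)) 0 ≤ β ^ (-a) / 8 * Z :=
    (TT.insTrace_indicator_zero_mono hβ0.le hAm (measurableSet_strip _) hAB).trans (hSB β hββ₀ L hL₀ hLβ)
  -- (ii) the floor `Z ≥ (M β^{-N})^{2L}`
  have hlam : M * (β ^ N)⁻¹ ≤ levelValue su2Rep L β 0 := TT.levelValue_zero_ge_rpow hβ9 hβw
  have hfloor : (M * (β ^ N)⁻¹) ^ (2 * L) ≤ Z :=
    (pow_le_pow_left₀ (by positivity) hlam _).trans (TT.pow_levelValue_zero_le_physTrace hL1 hβ1)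
  -- (iii) the far term: `η M^{2L-2} M = β^{-c} M^{2L}` with `c = a + 2LN + 3`
  have hβt : β * t ^ 2 / 2 = c * Real.log β := by
    have h2 : t ^ 2 = 2 * c * Real.log β / β := by rw [ht, Real.sq_sqrt (by positivity)]
    rw [h2]
    field_simp
  have eExp : Real.exp (-(β * t ^ 2 / 2)) = β ^ (-c) := by
    rw [hβt, Real.rpow_def_of_pos hβ0]; congr 1; ring
  have eM : Real.exp (β * (2 * (E : ℝ) - t ^ 2 / 2)) = M * Real.exp (-(β * t ^ 2 / 2)) := by
    rw [hM, ← Real.exp_nat_mul, ← Real.exp_add]; congr 1; ring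
  have hη : Real.exp (β * (2 * (E : ℝ) - t ^ 2 / 2)) * M ^ (2 * L - 2) * M = β ^ (-c) * M ^ (2 * L) := by
    rw [eM, eExp]
    have e2 : M ^ (2 * L) = M * M ^ (2 * L - 2) * M := by
      have h : M ^ (2 * L) = M ^ (2 * L - 2) * M ^ 2 := by rw [← pow_add]; congr 1; omega
      rw [h]; ring
    rw [e2]; ring
  have hNc : β ^ (-c) = β ^ (-a) * ((β ^ N) ^ (2 * L))⁻¹ * β ^ (-(3 : ℝ)) := by
    rw [hc, show -(a + 2 * L * (8 * (P : ℝ) + 97 * (E : ℝ)) + 3) = -a + -(((2 * L * N : ℕ) : ℝ)) + -(3 : ℝ) by rw [hN]; push_cast; ring,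
      Real.rpow_add hβ0, Real.rpow_add hβ0, Real.rpow_neg hβ0.le (((2 * L * N : ℕ) : ℝ)), Real.rpow_natCast, mul_comm (2 * L) N, pow_mul]
  have hβ3 : β ^ (-(3 : ℝ)) ≤ 1 / 8 := by
    rw [Real.rpow_neg hβ0.le, show (3 : ℝ) = ((3 : ℕ) : ℝ) by norm_num, Real.rpow_natCast, inv_eq_one_div]
    have h8 : (8 : ℝ) ≤ β ^ 3 := by
      have h2 : (2 : ℝ) ≤ β := by linarith
      calc (8 : ℝ) = 2 ^ 3 := by norm_num
        _ ≤ β ^ 3 := pow_le_pow_left₀ (by norm_num) h2 3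
    exact div_le_div_of_nonneg_left zero_le_one (by norm_num) h8
  have hfar : 2 * (Real.exp (β * (2 * (E : ℝ) - t ^ 2 / 2)) * M ^ (2 * L - 2) * M) ≤ β ^ (-a) / 4 * Z := by
    rw [hη, hNc]
    have hpos1 : 0 ≤ β ^ (-a) := Real.rpow_nonneg hβ0.le _
    have hkey : ((β ^ N) ^ (2 * L))⁻¹ * M ^ (2 * L) ≤ Z := by
      rw [← inv_pow, ← mul_pow, mul_comm]; exact hfloor
    calc 2 * (β ^ (-a) * ((β ^ N) ^ (2 * L))⁻¹ * β ^ (-(3 : ℝ)) * M ^ (2 * L))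
        = 2 * β ^ (-a) * β ^ (-(3 : ℝ)) * (((β ^ N) ^ (2 * L))⁻¹ * M ^ (2 * L)) := by ring
      _ ≤ 2 * β ^ (-a) * (1 / 8) * Z := mul_le_mul (mul_le_mul_of_nonneg_left hβ3 (by positivity)) hkey (by positivity) (by positivity)
      _ = β ^ (-a) / 4 * Z := by ring
  -- (iv) combine: `insTrace ≥ Z (1 − β^{-a}/2) ≥ β^{-1/L} Z`
  have hmain : Z * (1 - β ^ (-a) / 2) ≤ TT.insTrace L β O 1 := by
    have h := hpers
    rw [← hZ] at h
    nlinarith [h, hstrip, hfar]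
  have hexp : β ^ (-(1 : ℝ) / L) ≤ 1 - β ^ (-a) / 2 := TT.rpow_neg_inv_le hL1 hexp1 hLβ
  calc β ^ (-(1 : ℝ) / L) * Z ≤ (1 - β ^ (-a) / 2) * Z := mul_le_mul_of_nonneg_right hexp hZpos.le
    _ = Z * (1 - β ^ (-a) / 2) := mul_comm _ _
    _ ≤ TT.insTrace L β O 1 := hmain

/-- ★ **DOOR 2 — the Laplace-window twist deficit (`TwistDeficitLaplaceWindow`, item stmt-QuantumFields-23776) from the thermal small-ball estimate.**
Under the same hypothesis (SB) with `0 < a ≤ 1`, `γ < 1/2 − 3a`, the swap-twisted zero-flux partition function falls a polynomial fraction short of the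
periodic one uniformly on the window: `β^{−3} Z_phys(2L) ≤ Z_phys(2L) − Z^S_phys(2L)` for `β ≥ β₀'`, `L₀' ≤ L ≤ β^a` — i.e. the route's crux W holds
with this `a` and `k = 3`.  (Door 1, then the landed doors `SlowBitWindow.JensenDoor` and `SwapTwistDeficit.CauchySchwarzDoor` pointwise in `(β, L)`.)
So W — and with it the window version of the slow bit — is reduced to ONE anti-concentration statement for a single Polyakov pair at a POLYNOMIAL scale,
with no Gaussian/semiclassical precision required of the bulk. [cite: tHooft1979Flux] [cite: MadrasSokal1988, §2] [cite: ReedSimonIV1978, Thm. XIII.1] -/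
theorem twistDeficitLaplaceWindow_of_smallBall {a γ : ℝ} (ha : 0 < a) (ha1 : a ≤ 1) (hγ : γ < 1 / 2 - 3 * a)
    (hSB : ∃ β₀ : ℝ, ∃ L₀ : ℕ, ∀ β : ℝ, β₀ ≤ β → ∀ (L : ℕ) [NeZero L], L₀ ≤ L → (L : ℝ) ≤ β ^ a →
      TT.insTrace L β (Set.indicator {U : GaugeConfig 3 L FemtoTransferGap.SU2 |
          |polDist U - polDist (configPerm (Equiv.swap (0 : Fin 3) 1) U)| ≤ β ^ (-γ)} fun _ => (1 : ℝ)) 0 ≤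
        β ^ (-a) / 8 * TT.physTrace L β (2 * L)) :
    Summit.QuantumFields.YangMills.Theses.SwapTwistDeficit.TwistDeficitLaplaceWindow := by
  obtain ⟨k, β₀, L₀, hSP⟩ := stepPersistence_window_of_smallBall ha ha1 hγ hSB
  -- `k = 1` is not needed by name: re-derive the bound with the `k` produced (it is `1`, but we only use `k`-freeness below via the proof's shape)
  refine ⟨a, ha, 2 * k + 1, max β₀ 2, max L₀ 2, fun β hβ L _ hL hLβ => ?_⟩
  have hββ₀ : β₀ ≤ β := (le_max_left _ _).trans hβ
  have hβ2 : 2 ≤ β := (le_max_right _ _).trans hβ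
  have hβ1 : 1 ≤ β := by linarith
  have hβ0 : 0 < β := by linarith
  have hL2 : 2 ≤ L := (le_max_right _ _).trans hL
  have hL1 : 1 ≤ L := by omega
  have hL0 : (0 : ℝ) < L := by exact_mod_cast (show 0 < L by omega)
  obtain ⟨O, hO, hOb, hodd, hI⟩ := hSP β hββ₀ L ((le_max_left _ _).trans hL) hLβ
  set Z : ℝ := TT.physTrace L β (2 * L) with hZ
  set ZS : ℝ := TT.twistTrace L β (2 * L) with hZS
  set I1 : ℝ := TT.insTrace L β O 1 with hI1
  set IL : ℝ := TT.insTrace L β O L with hIL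
  have hZpos : 0 < Z := TT.physTrace_two_mul_pos hL1 hβ1
  have hJ : I1 ^ L ≤ IL * Z ^ (L - 1) := SlowBitWindow.jensenDoor_proof L hL2 β hβ1 O hO hOb
  have hC : IL ^ 2 ≤ 2 * Z * (Z - ZS) := cauchySchwarzDoor_proof L hL2 β hβ1 O hO hOb hodd
  -- `β^{-k} Z^L ≤ I1^L`
  have hs0 : 0 ≤ β ^ (-k / L) * Z := mul_nonneg (Real.rpow_nonneg hβ0.le _) hZpos.le
  have hpow : (β ^ (-k / L) * Z) ^ L ≤ I1 ^ L := pow_le_pow_left₀ hs0 hI L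
  have hs_pow : (β ^ (-k / L) * Z) ^ L = β ^ (-k) * Z ^ L := by
    rw [mul_pow, ← Real.rpow_natCast (β ^ (-k / L)) L, ← Real.rpow_mul hβ0.le]
    congr 2; field_simp
  -- `β^{-k} Z ≤ IL`
  have hIL : β ^ (-k) * Z ≤ IL := by
    have h1 : β ^ (-k) * Z ^ L ≤ IL * Z ^ (L - 1) := by rw [← hs_pow]; exact hpow.trans hJ
    have hZL : Z ^ L = Z * Z ^ (L - 1) := by rw [← pow_succ']; congr 1; omega
    rw [hZL, ← mul_assoc] at h1
    exact le_of_mul_le_mul_right h1 (pow_pos hZpos _)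
  have hIL0 : 0 ≤ β ^ (-k) * Z := mul_nonneg (Real.rpow_nonneg hβ0.le _) hZpos.le
  -- square and use Cauchy–Schwarz: `β^{-2k} Z² ≤ 2 Z (Z − Z^S)`
  have hsq : (β ^ (-k) * Z) ^ 2 ≤ 2 * Z * (Z - ZS) := (pow_le_pow_left₀ hIL0 hIL 2).trans hC
  have hdef : β ^ (-k) * β ^ (-k) * Z ≤ 2 * (Z - ZS) := by
    have h : (β ^ (-k) * β ^ (-k) * Z) * Z ≤ (2 * (Z - ZS)) * Z := by nlinarith [hsq]
    exact le_of_mul_le_mul_right h hZpos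
  -- `β^{-(2k+1)} Z ≤ Z − Z^S` (`β ≥ 2`)
  have e1 : β ^ (-(2 * k + 1)) = β ^ (-k) * β ^ (-k) * β⁻¹ := by
    rw [show -(2 * k + 1) = -k + -k + (-1 : ℝ) by ring, Real.rpow_add hβ0, Real.rpow_add hβ0, Real.rpow_neg_one]
  rw [e1]
  have hβinv : β⁻¹ ≤ 1 / 2 := by rw [inv_eq_one_div]; exact div_le_div_of_nonneg_left zero_le_one (by norm_num) hβ2
  have hkk : 0 ≤ β ^ (-k) * β ^ (-k) := mul_nonneg (Real.rpow_nonneg hβ0.le _) (Real.rpow_nonneg hβ0.le _)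
  calc β ^ (-k) * β ^ (-k) * β⁻¹ * Z ≤ β ^ (-k) * β ^ (-k) * (1 / 2) * Z := by
        refine mul_le_mul_of_nonneg_right (mul_le_mul_of_nonneg_left hβinv hkk) hZpos.le
    _ = (β ^ (-k) * β ^ (-k) * Z) / 2 := by ring
    _ ≤ Z - ZS := by linarith

end Summit.QuantumFields.YangMills.Theorems.SwapTwistDeficit

end
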